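import Summits.BirchSwinnertonDyer.BirchSwinnertonDyer.Theorems.UniversalToricDescentLambdaTransport
import Summits.BirchSwinnertonDyer.BirchSwinnertonDyer.Theorems.UniversalToricDescentTowerNoPTorsionTwin
import Summits.BirchSwinnertonDyer.Rank1Residual.X11b.Three.ControlIdentityOdd
import Summits.BirchSwinnertonDyer.Rank1Residual.Additive.PotSupersingularClasses
import HarnessLib

/-!
# Route UniversalToricDescent — hypothesis (L) of the λ-transport DISCHARGED at the crux's strict
# place `𝔭′`: `E′(K_{∞,𝔭′})[p] = 0 ⟸ E(ℚ_p)[p] = 0`, and the other prime above `3` is of degree one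

Lead prover bsd-wall-utd-p1 g7 (`--supports stmt-BirchSwinnertonDyer-20399`; PRICING-20399-ALG-HALF §2 (L),
g6's open list «(L)-descent»). The `Σ`-imprimitive λ-, μ- and torsion-transport landed by g6
(`UniversalToricDescentLambdaTransport.lambdaInvariant_baseChange_eq_of_modPCongruent`) carries the
hypothesis (L) «no non-zero `p`-torsion point of `E′[p^∞]` is fixed by `ker κ ⊓ D_𝔭`» at the STRICT place
`𝔭` of Castella's Selmer group. In crux #2 / 21845 the strict place is the OTHER prime `𝔭′ ∋ 3`,
`𝔭′ ≠ 𝔭`, of the Heegner field `K`. This file discharges (L) there from ONE decidable condition on the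
wild curve over `ℚ₃`:

* §1 `degreeOne_of_dvd_conductor_of_heegner` — every prime of `K` above a prime `p ∣ N` is of degree one
  under the Heegner hypothesis for `N` (`p` splits; tree `X11b.degreeOne_of_splitsIn`); so the crux's
  `𝔭′` has `e = f = 1` (`degreeOne_otherPrime_three`).
* §2 `noFixedPTorsion_kerSubgroup_inf_decomp_of_noPTorsionPadic` — for `W/ℚ`, any number field `K`,
  ANY `ℤ_p`-extension `κ`, a degree-one `𝔭 ∋ p`: (iv) `E(ℚ_p)[p] = 0` ⟹ (L) at `𝔭` in the exact
  shape of g6's binder (pro-`p` descent, tree `X11b.AcSelmer.fixedPoints_decomp_inf_kerSubgroup_eq_bot_of_noPTorsion`,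
  Castella 2018 erratum Lemma 2.1); `…_of_modPCongruent` — the same for the mod-`p` twin `W′` from
  (iv) FOR `W` (`E′[p] ≅ E[p]`, g5's `baseChange_noPTorsion_iff_of_modPCongruent`).
* §3 `lambdaInvariant_baseChange_eq_of_modPCongruent_of_noPTorsionPadic` — g6's transport with (L)
  replaced by (iv) for the wild curve; §4 `…_three_at_otherPrime` — the `p = 3` reading at the crux's
  strict place `𝔭′` (degree one by §1), i.e. the `Σ`-imprimitive algebraic λ-half of 21845 on the
  1 817 / 2 023 habitat classes with `E(ℚ₃)[3] = 0` (census Q-T3), modulo (N1) at `Σ`-level for both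
  curves and the twin's torsion + `μ = 0`.

HONEST STATUS: helper theorems; (N1) at `Σ`-level (both curves), the passage `Σ → ∅` and the analytic
half of 21845 remain; the 206 habitat classes with `E(ℚ₃)[3] ≠ 0` are not covered by (iv). THEOREMS
ONLY; no definition, no named fact, no `sorry`. BSD is not advanced by this file.
References: [Castella2018Erratum] Thm. 1.1 (iv), Lemma 2.1; [GreenbergVatsal2000] Thm. (1.4), §2
Prop. (2.8); [GreenbergLNM1716] proof of Prop. 4.8 (p. 109); [GrossLMS1991] §1 (Heegner hypothesis).
-/

set_option autoImplicit false
-- `…BirchSwinnertonDyer.BirchSwinnertonDyer.Theorems…` is the problem's mandated namespace (D-0017).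
set_option linter.dupNamespace false

noncomputable section

open scoped Classical

namespace Summit.BirchSwinnertonDyer.BirchSwinnertonDyer.Theorems.UniversalToricDescentStrictPlace

open NumberField IsDedekindDomain Field WeierstrassCurve
open Literature.NumberTheory.EllipticCurves Literature.NumberTheory.EllipticCurves.IwasawaAlgebra
  Literature.NumberTheory.EllipticCurves.GreenbergSelmer
  Literature.NumberTheory.GaloisRepresentations Literature.NumberTheory.EllipticCurves.Rank1Residual
  Summit.BirchSwinnertonDyer.Rank1Residual Summit.BirchSwinnertonDyer.Rank1Residual.X11b
  Summit.BirchSwinnertonDyer.Rank1Residual.X11b.AcSelmer Summit.BirchSwinnertonDyer.Rank1Residual.Iwasawa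
  Summit.BirchSwinnertonDyer.BirchSwinnertonDyer.Theorems.UniversalToricDescentTowerTorsion
  Summit.BirchSwinnertonDyer.BirchSwinnertonDyer.Theorems.UniversalToricDescentLambdaTransport

/-! ### §1 Primes above `p ∣ N` in a Heegner field are of degree one -/

section DegreeOne

variable {K : Type} [Field K] [NumberField K]

/-- **Under the Heegner hypothesis for `N`, every prime of `K` above a prime `p ∣ N` has
`e = f = 1`**: `p` splits in `K` (`SatisfiesHeegnerHypothesis`: two primes above `p`), and in a
quadratic field split primes are of degree one (`X11b.degreeOne_of_splitsIn`).
[cite: GrossLMS1991, §1 (p. 235), the Heegner hypothesis] -/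
theorem degreeOne_of_dvd_of_heegner {N p : ℕ} [Fact p.Prime] (hK : IsImaginaryQuadratic K)
    (hHe : SatisfiesHeegnerHypothesis N K) (hpN : p ∣ N)
    {𝔮 : HeightOneSpectrum (𝓞 K)} (h𝔮 : ((p : ℕ) : 𝓞 K) ∈ 𝔮.asIdeal) :
    𝔮.asIdeal.ramificationIdx (𝓞 ℚ) = 1 ∧ 𝔮.asIdeal.inertiaDeg (𝓞 ℚ) = 1 :=
  degreeOne_of_splitsIn hK.1 (hHe p Fact.out hpN) h𝔮

/-- **For `W/ℚ` of conductor `N` with bad reduction at `p` and `K` Heegner for `N`, every `𝔮 ∋ p` of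
`K` is of degree one.** [cite: GrossLMS1991, §1 (p. 235)] -/
theorem degreeOne_of_dvd_conductor_of_heegner {W : WeierstrassCurve ℚ} [W.IsElliptic] {N p : ℕ}
    [Fact p.Prime] (hbad : ¬ W.HasGoodReductionAtPrime p) (hN : W.conductorNorm ℤ = N)
    (hK : IsImaginaryQuadratic K) (hHe : SatisfiesHeegnerHypothesis N K)
    {𝔮 : HeightOneSpectrum (𝓞 K)} (h𝔮 : ((p : ℕ) : 𝓞 K) ∈ 𝔮.asIdeal) :
    𝔮.asIdeal.ramificationIdx (𝓞 ℚ) = 1 ∧ 𝔮.asIdeal.inertiaDeg (𝓞 ℚ) = 1 :=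
  degreeOne_of_dvd_of_heegner hK hHe
    (hN ▸ (W.dvd_conductorNorm_iff_not_hasGoodReductionAtPrime p).mpr hbad) h𝔮

/-- **The crux's other prime `𝔭′ ∋ 3` is of degree one** (binders of 20186 / 20399 / 21845: `E` wild at
`3`, `N = N(E)`, `K` imaginary quadratic Heegner for `N`). [cite: GrossLMS1991, §1 (p. 235)] -/
theorem degreeOne_otherPrime_three {W : WeierstrassCurve ℚ} [W.IsElliptic] [W.IsGloballyMinimal]
    {N : ℕ} (hO6 : Additive.ClassO6 W 3) (hN : W.conductorNorm ℤ = N) (hK : IsImaginaryQuadratic K)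
    (hHe : SatisfiesHeegnerHypothesis N K) {𝔭' : HeightOneSpectrum (𝓞 K)}
    (h𝔭' : ((3 : ℕ) : 𝓞 K) ∈ 𝔭'.asIdeal) :
    𝔭'.asIdeal.ramificationIdx (𝓞 ℚ) = 1 ∧ 𝔭'.asIdeal.inertiaDeg (𝓞 ℚ) = 1 :=
  degreeOne_of_dvd_conductor_of_heegner (p := 3) hO6.2.1.1 hN hK hHe h𝔭'

end DegreeOne

/-! ### §2 (iv) `E(ℚ_p)[p] = 0` ⟹ (L) at a degree-one strict place, for `E` and for its mod-`p` twin -/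

section L

variable (W : WeierstrassCurve ℚ) [W.IsElliptic] (p : ℕ) [Fact p.Prime] {K : Type} [Field K]
  [NumberField K]

/-- **(iv) ⟹ (L).** For `W/ℚ`, any number field `K`, ANY `ℤ_p`-extension `κ` of `K` and a degree-one
prime `𝔭 ∋ p`: if `E(ℚ_p)[p] = 0` then no non-zero point of `E(K̄)[p^∞]` is fixed by `ker κ ⊓ D_𝔭`
(so in particular no non-zero `p`-torsion point — hypothesis (L) of
`UniversalToricDescentLambdaTransport`, verbatim). Transport along `K_𝔭 ≃ ℚ_p`, Galois descent to
`D_𝔭`, then the fixed-point principle for the pro-`p` group `D_𝔭/(D_𝔭 ⊓ ker κ)` — all in the tree's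
`X11b.AcSelmer.fixedPoints_decomp_inf_kerSubgroup_eq_bot_of_noPTorsion`.
[cite: Castella2018Erratum, Thm. 1.1 (iv) and Lemma 2.1 (pp. 1–2)] [cite: GreenbergLNM1716, proof of Prop. 4.8 (p. 109)] -/
theorem noFixedPTorsion_kerSubgroup_inf_decomp_of_noPTorsionPadic
    (h4 : ∀ R : (W.baseChange ℚ_[p]).toAffine.Point, p • R = 0 → R = 0)
    (κ : ZpExtension K p) {𝔭 : HeightOneSpectrum (𝓞 K)} (h𝔭 : ((p : ℕ) : 𝓞 K) ∈ 𝔭.asIdeal)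
    (he : 𝔭.asIdeal.ramificationIdx (𝓞 ℚ) = 1) (hf : 𝔭.asIdeal.inertiaDeg (𝓞 ℚ) = 1) :
    ∀ m : (W.baseChange K).geomPrimaryTorsion p,
      (∀ σ ∈ κ.kerSubgroup ⊓ decomp 𝔭, σ • m = m) → p • m = 0 → m = 0 := by
  intro m hfix _
  have h := AcSelmer.fixedPoints_decomp_inf_kerSubgroup_eq_bot_of_noPTorsion W p h4 K κ 𝔭 h𝔭 he hf
  have hmem : m ∈ FixedPoints.addSubgroup ↥(decomp 𝔭 ⊓ κ.kerSubgroup)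
      ((W.baseChange K).geomPrimaryTorsion p) := by
    refine (FixedPoints.mem_addSubgroup _ _ m).mpr fun d ↦ ?_
    have hd : (d : absoluteGaloisGroup K) ∈ κ.kerSubgroup ⊓ decomp 𝔭 := by
      rw [inf_comm]; exact d.2
    exact hfix d hd
  rw [h] at hmem
  exact (AddSubgroup.mem_bot).mp hmem

/-- **(iv) for `W` ⟹ (L) for the mod-`p` TWIN `W′`** (`ModPCongruent W′ W p`: `E′[p] ≅ E[p]`
`Γ_ℚ`-equivariantly, so `E′(ℚ_p)[p] = 0 ↔ E(ℚ_p)[p] = 0`, g5's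
`baseChange_noPTorsion_iff_of_modPCongruent`), at any degree-one `𝔭 ∋ p` of any number field `K` and
any `ℤ_p`-extension. [cite: Castella2018Erratum, Lemma 2.1 (pp. 1–2)] [cite: Serre1972, §4] -/
theorem noFixedPTorsion_kerSubgroup_inf_decomp_twin_of_noPTorsionPadic (W' : WeierstrassCurve ℚ)
    [W'.IsElliptic] (hcong : O6.ModPCongruent W' W p)
    (h4 : ∀ R : (W.baseChange ℚ_[p]).toAffine.Point, p • R = 0 → R = 0)
    (κ : ZpExtension K p) {𝔭 : HeightOneSpectrum (𝓞 K)} (h𝔭 : ((p : ℕ) : 𝓞 K) ∈ 𝔭.asIdeal)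
    (he : 𝔭.asIdeal.ramificationIdx (𝓞 ℚ) = 1) (hf : 𝔭.asIdeal.inertiaDeg (𝓞 ℚ) = 1) :
    ∀ m : (W'.baseChange K).geomPrimaryTorsion p,
      (∀ σ ∈ κ.kerSubgroup ⊓ decomp 𝔭, σ • m = m) → p • m = 0 → m = 0 :=
  noFixedPTorsion_kerSubgroup_inf_decomp_of_noPTorsionPadic W' p
    ((baseChange_noPTorsion_iff_of_modPCongruent p W W' ℚ_[p] hcong).mp h4) κ h𝔭 he hf

end L

/-! ### §3 g6's `Σ`-imprimitive transport with (L) discharged by (iv) for the wild curve -/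

section Transport

variable {p : ℕ} [Fact p.Prime]

/-- **λ-, μ- and torsion-transport for the route's twin, (L) replaced by (iv) `E(ℚ_p)[p] = 0`.** As
`UniversalToricDescentLambdaTransport.lambdaInvariant_baseChange_eq_of_modPCongruent` (`W, W′/ℚ` with
`W′[p] ≅ W[p]`, `K` a number field, ANY `ℤ_p`-extension `κ` with topological generator `γ`, `p` odd, a
finite `Σ ∌ 𝔭` containing the bad places of `W_K`, `W′_K` prime to `p`, no non-zero finite
`Λ`-submodule in either `X_ac^Σ`, the twin's `X_ac^Σ(W′_K)` torsion with `μ = 0`), except that the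
strict place `𝔭 ∋ p` is assumed of DEGREE ONE and (L) is replaced by (iv) for the WILD curve `W`.
Conclusion: `X_ac^Σ(W_K)` is torsion with `μ = 0` and `λ(X_ac^Σ(W_K)) = λ(X_ac^Σ(W′_K))`.
[cite: GreenbergVatsal2000, Thm. (1.4) and §2 Prop. (2.8)] [cite: Castella2018Erratum, Lemma 2.1] -/
theorem lambdaInvariant_baseChange_eq_of_modPCongruent_of_noPTorsionPadic (W W' : WeierstrassCurve ℚ)
    [W.IsElliptic] [W'.IsElliptic] (K : Type) [Field K] [NumberField K] (κ : ZpExtension K p)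
    (γ : absoluteGaloisGroup K) [Fact (κ.IsTopGenerator γ)]
    (hp : p ≠ 2) {𝔭 : HeightOneSpectrum (𝓞 K)} (h𝔭 : ((p : ℕ) : 𝓞 K) ∈ 𝔭.asIdeal)
    (he : 𝔭.asIdeal.ramificationIdx (𝓞 ℚ) = 1) (hf : 𝔭.asIdeal.inertiaDeg (𝓞 ℚ) = 1)
    {S : Set (HeightOneSpectrum (𝓞 K))} (hS : S.Finite)
    (hSW : ∀ v : HeightOneSpectrum (𝓞 K), v ∉ S → ((p : ℕ) : 𝓞 K) ∉ v.asIdeal →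
      (W.baseChange K).HasGoodReductionAt v)
    (hSW' : ∀ v : HeightOneSpectrum (𝓞 K), v ∉ S → ((p : ℕ) : 𝓞 K) ∉ v.asIdeal →
      (W'.baseChange K).HasGoodReductionAt v)
    (hcong : O6.ModPCongruent W' W p)
    (h4 : ∀ R : (W.baseChange ℚ_[p]).toAffine.Point, p • R = 0 → R = 0)
    (hT' : Module.IsTorsion (IwasawaAlgebra p) (XAc (W'.baseChange K) p κ 𝔭 S γ))
    (hμ' : muInvariant p (XAc (W'.baseChange K) p κ 𝔭 S γ) = 0)
    (hnf' : ∀ N : Submodule (IwasawaAlgebra p) (XAc (W'.baseChange K) p κ 𝔭 S γ), Finite N → N = ⊥)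
    (hnf : ∀ N : Submodule (IwasawaAlgebra p) (XAc (W.baseChange K) p κ 𝔭 S γ), Finite N → N = ⊥) :
    Module.IsTorsion (IwasawaAlgebra p) (XAc (W.baseChange K) p κ 𝔭 S γ) ∧
      muInvariant p (XAc (W.baseChange K) p κ 𝔭 S γ) = 0 ∧
      lambdaInvariant p (XAc (W.baseChange K) p κ 𝔭 S γ) =
        lambdaInvariant p (XAc (W'.baseChange K) p κ 𝔭 S γ) :=
  lambdaInvariant_baseChange_eq_of_modPCongruent W W' K κ γ hp h𝔭 hS hSW hSW' hcong
    (noFixedPTorsion_kerSubgroup_inf_decomp_twin_of_noPTorsionPadic W p W' hcong h4 κ h𝔭 he hf)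
    hT' hμ' hnf' hnf

end Transport

/-! ### §4 `p = 3` at the crux's strict place `𝔭′` -/

section Three

/-- **The `Σ`-imprimitive algebraic λ-half of 21845 at the crux's strict place `𝔭′`, on the habitat
classes with `E(ℚ₃)[3] = 0`.** Binders of crux #2 / 21845: `E/ℚ` wild at `3` (`ClassO6 W 3`),
`N = N(E)`, a mod-`3` twin `W′` (`ModPCongruent W′ W 3`), `K` imaginary quadratic Heegner for `N`,
ANY `ℤ₃`-extension `κ` with topological generator `γ`, `𝔭′ ∋ 3` (degree one by §1, no hypothesis
`𝔭′ ≠ 𝔭` needed), a finite `Σ ∌ 𝔭′` containing the bad places of `W_K`, `W′_K` prime to `3`,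
(iv) `E(ℚ₃)[3] = 0`: if the twin's `X_ac^Σ(W′_K)` (strict at `𝔭′`) is torsion with `μ = 0` and neither
`X_ac^Σ` has a non-zero finite `Λ`-submodule, then `X_ac^Σ(W_K)` is torsion with `μ = 0` and
`λ(X_ac^Σ(W_K)) = λ(X_ac^Σ(W′_K))`. What it still leaves of 21845's algebraic half: (N1) at `Σ`-level
(at `Σ = ∅` see `UniversalToricDescentNoFiniteSubmoduleOfCoinvariants`), the passage `Σ → ∅`, the twin's
torsion/`μ = 0` at `Σ`-level (g6 `SigmaPassage` + 20400 by name).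
[cite: GreenbergVatsal2000, Thm. (1.4) and §2 Prop. (2.8)] [cite: Castella2018Erratum, Lemma 2.1] -/
theorem lambdaInvariant_baseChange_eq_three_at_otherPrime (W W' : WeierstrassCurve ℚ) [W.IsElliptic]
    [W.IsGloballyMinimal] [W'.IsElliptic] {N : ℕ} (K : Type) [Field K] [NumberField K]
    (hO6 : Additive.ClassO6 W 3) (hN : W.conductorNorm ℤ = N) (hcong : O6.ModPCongruent W' W 3)
    (hK : IsImaginaryQuadratic K) (hHe : SatisfiesHeegnerHypothesis N K)
    (κ : ZpExtension K 3) (γ : absoluteGaloisGroup K) [Fact (κ.IsTopGenerator γ)]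
    {𝔭' : HeightOneSpectrum (𝓞 K)} (h𝔭' : ((3 : ℕ) : 𝓞 K) ∈ 𝔭'.asIdeal)
    {S : Set (HeightOneSpectrum (𝓞 K))} (hS : S.Finite)
    (hSW : ∀ v : HeightOneSpectrum (𝓞 K), v ∉ S → ((3 : ℕ) : 𝓞 K) ∉ v.asIdeal →
      (W.baseChange K).HasGoodReductionAt v)
    (hSW' : ∀ v : HeightOneSpectrum (𝓞 K), v ∉ S → ((3 : ℕ) : 𝓞 K) ∉ v.asIdeal →
      (W'.baseChange K).HasGoodReductionAt v)
    (h4 : ∀ R : (W.baseChange ℚ_[3]).toAffine.Point, 3 • R = 0 → R = 0)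
    (hT' : Module.IsTorsion (IwasawaAlgebra 3) (XAc (W'.baseChange K) 3 κ 𝔭' S γ))
    (hμ' : muInvariant 3 (XAc (W'.baseChange K) 3 κ 𝔭' S γ) = 0)
    (hnf' : ∀ M : Submodule (IwasawaAlgebra 3) (XAc (W'.baseChange K) 3 κ 𝔭' S γ), Finite M → M = ⊥)
    (hnf : ∀ M : Submodule (IwasawaAlgebra 3) (XAc (W.baseChange K) 3 κ 𝔭' S γ), Finite M → M = ⊥) :
    Module.IsTorsion (IwasawaAlgebra 3) (XAc (W.baseChange K) 3 κ 𝔭' S γ) ∧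
      muInvariant 3 (XAc (W.baseChange K) 3 κ 𝔭' S γ) = 0 ∧
      lambdaInvariant 3 (XAc (W.baseChange K) 3 κ 𝔭' S γ) =
        lambdaInvariant 3 (XAc (W'.baseChange K) 3 κ 𝔭' S γ) := by
  obtain ⟨he', hf'⟩ := degreeOne_otherPrime_three hO6 hN hK hHe h𝔭'
  exact lambdaInvariant_baseChange_eq_of_modPCongruent_of_noPTorsionPadic W W' K κ γ (by decide)
    h𝔭' he' hf' hS hSW hSW' hcong h4 hT' hμ' hnf' hnf

end Three

end Summit.BirchSwinnertonDyer.BirchSwinnertonDyer.Theorems.UniversalToricDescentStrictPlace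

end
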